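import Literature.NumberTheory.Rogawski1990.CohomologicalSpectrumInnerForm
import Literature.NumberTheory.Automorphic.HilbertRepSpectrumProofs
import HarnessLib

/-!
# FLOOR-0 junction T7, glue g1-an / g2 (GENERIC): distinct discrete automorphic representations are ORTHOGONAL under
# multiplicity one, the family of their spaces is INDEPENDENT, independence TRANSPORTS to «parts» cut out by an injective
# realisation `ℓ`, and parts are STABLE under translation

Cell hodgecm-mathlib, FLOOR 0; crux item H413 = stmt-HodgeConjecture-24833 (route `HCCMUnconditional`); prover F0P3-p04 (g0),
share «junction T7» — the ANALYTIC input of the glue g1/g2 of the integrator's JUNCTION SPEC (`F0/P3/ENGINE-INTERFACES.F0P3g0.md`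
§6/§6a, F0P3-plan (g0) 2026-08-30T21:55Z–21:59Z); the equivariant-components ALGEBRA over an independent stable family is
A-p09 (g18)'s `Theorems/F0P3EquivariantComponents.lean`, NOT here.  PROOF FILE: theorems only — no definition, no instance, no
notation, no named fact, no `sorry`.  HONEST LABEL: HC_CM is proved only modulo the printed citations until rung 0 closes.

WHAT IS PROVED:
* §1 (M⁻) `isOrtho_of_ne`: for a UNITARY representation `π` with MULTIPLICITY ONE (★ `ContRepresentation.HasMultiplicityOne`),
  two DISTINCT topologically irreducible closed subrepresentations are orthogonal — if `W' ≰ Wᗮ`, the isometric part of the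
  compressed projection (★ `ClosedSubrep.exists_le_orthogonal_areUnitarilyEquivalent`, [DeitmarEchterhoff2014, Cor. 6.1.9]) puts
  an irreducible copy of `W'` inside `Wᗮᗮ = W`, which is `W` (★ `eq_of_le_of_isTopIrreducible`), so `W' ≃ W`, so `W' = W`
  ([Dixmier1977, §5.4]); hence `orthogonalFamily` / `iSupIndep` of any injective family of irreducible closed subrepresentations;
* §2 for the `L²` automorphic spectrum of ANY adelic group datum (★ `AutomorphicSpectrum`): `space_injective`, and under `HasMultiplicityOne (𝒢.rightRegular μ)`: `isOrtho_space_of_ne`, `orthogonalFamily_space`, `iSupIndep_space`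
  (the family `Π ↦ Π.space` of ALL discrete automorphic representations is independent);
* §3 for the unitary datum `U(H)` of a CM field: `hasMultiplicityOne_rightRegular_of_innerFormMultiplicityLeOne` — the ENGINE
  LETTER E1 ★ `Rogawski1990.innerFormMultiplicityLeOne` ([Rogawski1990, §14.6: Prop. 14.6.2, Thm. 14.6.4, Thm. 14.6.5]), taken
  as a HYPOTHESIS BY NAME, gives multiplicity one of `L²(U(H)(L⁺)\U(H)(𝔸_{L⁺}))` via ★ `hasMultiplicityOne_iff_multiplicity_le_one_holds`;
  hence `iSupIndep_space_of_innerFormMultiplicityLeOne`;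
* §4 PURE ALGEBRA (any ring): `iSupIndep_parts_of_injOn` — if `V : ι → Submodule` is independent and `ℓ : X →ₗ (Fin 2 → Y)` is
  injective on `A` coordinatewise, the PARTS `i ↦ A ⊓ ⨅ k, (V i).comap ((LinearMap.proj k).comp ℓ)` (token shape of programme P2's
  `cotPart / holPart / antiholPart`, `F0_P2CohSpectrumL2` §2b) form an independent family (g1-an); `mem_parts_of_mem` — a part is
  STABLE under a pair of operators `(R, T)` intertwined by `ℓ` on `A` when `A` is `R`-stable and `V i` is `T`-stable (g2).

## References
* [Dixmier1977] J. Dixmier, *C*-algebras* (1977), §5.4 (multiplicity; disjoint irreducible subrepresentations), §13.1.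
* [DeitmarEchterhoff2014] A. Deitmar, S. Echterhoff, *Principles of Harmonic Analysis*, 2nd ed. (2014), Cor. 6.1.9 (isometric part
  of an intertwiner between irreducibles).
* [Rogawski1990] J. Rogawski, *Automorphic representations of unitary groups in three variables*, Ann. of Math. Stud. 123 (1990),
  §14.6 pp. 241–245 (multiplicity one on the inner forms).
* [BorelJacquet1979] A. Borel, H. Jacquet, PSPM 33.1 (1979), §4.6 (the discrete spectrum).
-/

set_option autoImplicit false

-- the mandated namespace has the single-problem summit's repeated segment (`HodgeConjecture.HodgeConjecture`)
set_option linter.dupNamespace false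

noncomputable section

namespace Summit.HodgeConjecture.HodgeConjecture.Cruxes.H413.SpectrumJunction

open MeasureTheory NumberField Topology
open scoped InnerProductSpace Matrix ComplexOrder
open Literature.NumberTheory.Automorphic Literature.NumberTheory.Automorphic.UnitaryGroup

/-! ## §1 Multiplicity one ⇒ distinct irreducible closed subrepresentations are orthogonal -/

section Unitary

variable {G H : Type*} [Group G] [NormedAddCommGroup H] [InnerProductSpace ℂ H] [CompleteSpace H]
  {π : ContRepresentation ℂ G H}

/-- **M⁻ — distinct irreducibles are orthogonal under multiplicity one.**  For a unitary `π` with `HasMultiplicityOne`, two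
DISTINCT topologically irreducible closed subrepresentations `W ≠ W'` satisfy `W ⟂ W'`: otherwise `W' ≰ Wᗮ`, and the isometric
part of the compressed projection `P_{Wᗮᗮ}|_{W'}` gives an irreducible `W'' ≤ Wᗮᗮ = W` unitarily equivalent to `W'`; `W'' = W` by
irreducibility of `W`, so `W' ≃ W`, so `W' = W` by multiplicity one. [cite: Dixmier1977, §5.4] [cite: DeitmarEchterhoff2014, Cor. 6.1.9] -/
theorem isOrtho_of_ne (hπ : π.IsUnitary) (h1 : π.HasMultiplicityOne) {W W' : ContRepresentation.ClosedSubrep π}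
    (hW : W.toContRep.IsTopIrreducible) (hW' : W'.toContRep.IsTopIrreducible) (hne : W ≠ W') :
    W.toSubmodule ⟂ W'.toSubmodule := by
  suffices hle : W' ≤ W.orthogonal hπ from
    (Submodule.isOrtho_orthogonal_right W.toSubmodule).mono_right hle
  by_contra hle
  obtain ⟨W'', hW''le, hW''e⟩ :=
    ContRepresentation.ClosedSubrep.exists_le_orthogonal_areUnitarilyEquivalent hπ (W.orthogonal hπ) W' hW' hle
  rw [ContRepresentation.ClosedSubrep.orthogonal_orthogonal] at hW''le
  obtain ⟨e'', -⟩ := id hW''e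
  have hW''irr : W''.toContRep.IsTopIrreducible := (ContRepresentation.isTopIrreducible_congr e'').mp hW'
  have hW''eq : W'' = W := ContRepresentation.ClosedSubrep.eq_of_le_of_isTopIrreducible hW
    ((ContRepresentation.isTopIrreducible_iff _).mp hW''irr).1 hW''le
  subst hW''eq
  exact hne (h1 W' W'' hW' hW hW''e).symm

/-- Under multiplicity one, an INJECTIVE family of irreducible closed subrepresentations of a unitary `π` is an orthogonal family
(Mathlib `OrthogonalFamily` of the inclusions). [cite: Dixmier1977, §5.4] -/
theorem orthogonalFamily_of_injective (hπ : π.IsUnitary) (h1 : π.HasMultiplicityOne) {ι : Type*}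
    (W : ι → ContRepresentation.ClosedSubrep π) (hW : ∀ i, (W i).toContRep.IsTopIrreducible) (hinj : Function.Injective W) :
    OrthogonalFamily ℂ (fun i => ↥((W i).toSubmodule)) fun i => ((W i).toSubmodule).subtypeₗᵢ :=
  orthogonalFamily_iff_pairwise.mpr fun _ _ hij => isOrtho_of_ne hπ h1 (hW _) (hW _) (hinj.ne hij)

/-- Under multiplicity one, the spaces of an injective family of irreducible closed subrepresentations of a unitary `π` are
INDEPENDENT (`iSupIndep`: each meets the span of the others in `0`). [cite: Dixmier1977, §5.4] -/
theorem iSupIndep_of_injective (hπ : π.IsUnitary) (h1 : π.HasMultiplicityOne) {ι : Type*}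
    (W : ι → ContRepresentation.ClosedSubrep π) (hW : ∀ i, (W i).toContRep.IsTopIrreducible) (hinj : Function.Injective W) :
    iSupIndep fun i => (W i).toSubmodule :=
  (orthogonalFamily_of_injective hπ h1 W hW hinj).independent

end Unitary

/-! ## §2 The discrete automorphic spectrum of an adelic group datum -/

section Discrete

variable {K : Type} [Field K] [NumberField K] {𝒢 : AdelicGroupData.{0} K}
  {μ : Measure 𝒢.automorphicQuotient} [SMulInvariantMeasure 𝒢.Adelic 𝒢.automorphicQuotient μ]

/-- `P ↦ P.space` is injective: a discrete automorphic representation is determined by its space (the other field is a proof;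
cf. ★ `DiscreteAutomorphicRep.ext'` of `JacquetLanglandsPartsProofs`, not imported here to keep the closure small).
[cite: BorelJacquet1979, §4.6] -/
theorem space_injective : Function.Injective (fun P : DiscreteAutomorphicRep 𝒢 μ => P.space) := by
  intro P P' h
  cases P
  cases P'
  cases h
  rfl

/-- **Distinct discrete automorphic representations are orthogonal in `L²`** when the regular representation has multiplicity one
(it is unitary, ★ `isUnitary_rightRegular`). [cite: Dixmier1977, §5.4] [cite: BorelJacquet1979, §4.6] -/
theorem isOrtho_space_of_ne (h1 : (𝒢.rightRegular μ).HasMultiplicityOne) {P P' : DiscreteAutomorphicRep 𝒢 μ} (hne : P ≠ P') :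
    P.space.toSubmodule ⟂ P'.space.toSubmodule :=
  isOrtho_of_ne (𝒢.isUnitary_rightRegular μ) h1 P.irreducible P'.irreducible fun h => hne (space_injective h)

/-- Under multiplicity one, ALL discrete automorphic representations together form an orthogonal family in `L²`.
[cite: Dixmier1977, §5.4] -/
theorem orthogonalFamily_space (h1 : (𝒢.rightRegular μ).HasMultiplicityOne) :
    OrthogonalFamily ℂ (fun P : DiscreteAutomorphicRep 𝒢 μ => ↥(P.space.toSubmodule)) fun P => (P.space.toSubmodule).subtypeₗᵢ :=
  orthogonalFamily_of_injective (𝒢.isUnitary_rightRegular μ) h1 (fun P : DiscreteAutomorphicRep 𝒢 μ => P.space)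
    (fun P => P.irreducible) space_injective

/-- Under multiplicity one, the family `Π ↦ Π.space` of ALL discrete automorphic representations is INDEPENDENT in `L²`.
[cite: Dixmier1977, §5.4] [cite: BorelJacquet1979, §4.6] -/
theorem iSupIndep_space (h1 : (𝒢.rightRegular μ).HasMultiplicityOne) :
    iSupIndep fun P : DiscreteAutomorphicRep 𝒢 μ => P.space.toSubmodule :=
  (orthogonalFamily_space h1).independent

end Discrete

/-! ## §3 The unitary datum: letter E1 ⇒ multiplicity one of `L²` -/

section UnitaryDatum

/-- **E1 ⇒ multiplicity one of `L²(U(H)(L⁺)\U(H)(𝔸_{L⁺}))`.**  The engine letter E1 ★ `Rogawski1990.innerFormMultiplicityLeOne`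
(every discrete automorphic `P` of the inner form `U(H)` has `multiplicity ≤ 1`; [Rogawski1990, Prop. 14.6.2, Thm. 14.6.4, Thm. 14.6.5])
— taken as a HYPOTHESIS BY NAME — gives `HasMultiplicityOne` of the (unitary) regular representation, by
★ `hasMultiplicityOne_iff_multiplicity_le_one_holds` ([Dixmier1977, §5.4]). [cite: Rogawski1990, §14.6 Thm. 14.6.4] [cite: Dixmier1977, §5.4] -/
theorem hasMultiplicityOne_rightRegular_of_innerFormMultiplicityLeOne
    (hE1 : Literature.NumberTheory.Rogawski1990.innerFormMultiplicityLeOne)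
    (L : Type) [Field L] [NumberField L] [IsCMField L] (ι : L →+* ℂ) (H : Matrix (Fin 3) (Fin 3) L) (T : GL (Fin 3) ℂ)
    (hT : (T : Matrix (Fin 3) (Fin 3) ℂ)ᴴ * H.map ι * (T : Matrix (Fin 3) (Fin 3) ℂ) = Literature.Geometry.ComplexHyperbolic.BallModel.J)
    (hdef : ∀ τ' : L →+* ℂ, InfinitePlace.mk τ' ≠ InfinitePlace.mk ι → (H.map τ').PosDef)
    (h2 : 2 ≤ Module.finrank ℚ ↥(maximalRealSubfield L))
    (μ : Measure (adelicGroupData (↥(maximalRealSubfield L)) L (IsCMField.complexConj L) 3 H).automorphicQuotient)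
    [(adelicGroupData (↥(maximalRealSubfield L)) L (IsCMField.complexConj L) 3 H).IsAutomorphicMeasure μ] :
    ((adelicGroupData (↥(maximalRealSubfield L)) L (IsCMField.complexConj L) 3 H).rightRegular μ).HasMultiplicityOne :=
  (ContRepresentation.hasMultiplicityOne_iff_multiplicity_le_one_holds
      ((adelicGroupData (↥(maximalRealSubfield L)) L (IsCMField.complexConj L) 3 H).isUnitary_rightRegular μ)).mpr
    fun W hW => hE1 L ι H T hT hdef h2 μ ⟨W, hW⟩

/-- **E1 ⇒ the family `Π ↦ Π.space` of discrete automorphic representations of `U(H)` is INDEPENDENT in `L²`.**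
[cite: Rogawski1990, §14.6 Thm. 14.6.4] [cite: Dixmier1977, §5.4] -/
theorem iSupIndep_space_of_innerFormMultiplicityLeOne
    (hE1 : Literature.NumberTheory.Rogawski1990.innerFormMultiplicityLeOne)
    (L : Type) [Field L] [NumberField L] [IsCMField L] (ι : L →+* ℂ) (H : Matrix (Fin 3) (Fin 3) L) (T : GL (Fin 3) ℂ)
    (hT : (T : Matrix (Fin 3) (Fin 3) ℂ)ᴴ * H.map ι * (T : Matrix (Fin 3) (Fin 3) ℂ) = Literature.Geometry.ComplexHyperbolic.BallModel.J)
    (hdef : ∀ τ' : L →+* ℂ, InfinitePlace.mk τ' ≠ InfinitePlace.mk ι → (H.map τ').PosDef)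
    (h2 : 2 ≤ Module.finrank ℚ ↥(maximalRealSubfield L))
    (μ : Measure (adelicGroupData (↥(maximalRealSubfield L)) L (IsCMField.complexConj L) 3 H).automorphicQuotient)
    [(adelicGroupData (↥(maximalRealSubfield L)) L (IsCMField.complexConj L) 3 H).IsAutomorphicMeasure μ] :
    iSupIndep fun P : DiscreteAutomorphicRep (adelicGroupData (↥(maximalRealSubfield L)) L (IsCMField.complexConj L) 3 H) μ =>
      P.space.toSubmodule :=
  iSupIndep_space (hasMultiplicityOne_rightRegular_of_innerFormMultiplicityLeOne hE1 L ι H T hT hdef h2 μ)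

/-- **E1 ⇒ distinct discrete automorphic representations of `U(H)` are orthogonal.** [cite: Rogawski1990, §14.6 Thm. 14.6.4]
[cite: Dixmier1977, §5.4] -/
theorem isOrtho_space_of_ne_of_innerFormMultiplicityLeOne
    (hE1 : Literature.NumberTheory.Rogawski1990.innerFormMultiplicityLeOne)
    (L : Type) [Field L] [NumberField L] [IsCMField L] (ι : L →+* ℂ) (H : Matrix (Fin 3) (Fin 3) L) (T : GL (Fin 3) ℂ)
    (hT : (T : Matrix (Fin 3) (Fin 3) ℂ)ᴴ * H.map ι * (T : Matrix (Fin 3) (Fin 3) ℂ) = Literature.Geometry.ComplexHyperbolic.BallModel.J)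
    (hdef : ∀ τ' : L →+* ℂ, InfinitePlace.mk τ' ≠ InfinitePlace.mk ι → (H.map τ').PosDef)
    (h2 : 2 ≤ Module.finrank ℚ ↥(maximalRealSubfield L))
    (μ : Measure (adelicGroupData (↥(maximalRealSubfield L)) L (IsCMField.complexConj L) 3 H).automorphicQuotient)
    [(adelicGroupData (↥(maximalRealSubfield L)) L (IsCMField.complexConj L) 3 H).IsAutomorphicMeasure μ]
    {P P' : DiscreteAutomorphicRep (adelicGroupData (↥(maximalRealSubfield L)) L (IsCMField.complexConj L) 3 H) μ} (hne : P ≠ P') :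
    P.space.toSubmodule ⟂ P'.space.toSubmodule :=
  isOrtho_space_of_ne (hasMultiplicityOne_rightRegular_of_innerFormMultiplicityLeOne hE1 L ι H T hT hdef h2 μ) hne

end UnitaryDatum

/-! ## §4 Pure algebra: independence transports to «parts» cut out by an injective realisation; stability of parts -/

section Parts

variable {R : Type*} [Ring R] {X Y : Type*} [AddCommGroup X] [Module R X] [AddCommGroup Y] [Module R Y]

/-- **g1-an — the parts of an independent family are independent.**  Let `V : ι → Submodule R Y` be INDEPENDENT, `A ≤ X`, and
`ℓ : X →ₗ[R] (Fin 2 → Y)` injective on `A` coordinatewise (`f ∈ A`, `ℓ f k = 0 ∀ k ⇒ f = 0`).  Then the PARTS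
`i ↦ A ⊓ ⨅ k, (V i).comap ((LinearMap.proj k).comp ℓ)` (the `f ∈ A` all of whose coordinate images lie in `V i`) form an independent
family: a member of part `i` and of the span of the other parts has every `ℓ f k` in `V i ⊓ ⨆_{j ≠ i} V j = 0`.  (Token shape of
programme P2's `cotPart / holPart / antiholPart`.) [cite: Dixmier1977, §5.4] -/
theorem iSupIndep_parts_of_injOn {ι : Type*} (V : ι → Submodule R Y) (hV : iSupIndep V) (A : Submodule R X)
    (ℓ : X →ₗ[R] (Fin 2 → Y)) (hℓ : ∀ f ∈ A, (∀ k : Fin 2, ℓ f k = 0) → f = 0) :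
    iSupIndep fun i => A ⊓ ⨅ k : Fin 2, (V i).comap ((LinearMap.proj k).comp ℓ) := by
  rw [iSupIndep_def]
  intro i
  rw [Submodule.disjoint_def]
  intro f hfi hfrest
  have hfA : f ∈ A := (Submodule.mem_inf.mp hfi).1
  refine hℓ f hfA fun k => ?_
  -- `ℓ f k ∈ V i`
  have h1 : ℓ f k ∈ V i := by
    have := (Submodule.mem_iInf _).mp (Submodule.mem_inf.mp hfi).2 k
    simpa only [Submodule.mem_comap, LinearMap.coe_comp, Function.comp_apply, LinearMap.proj_apply] using this
  -- `ℓ f k ∈ ⨆_{j ≠ i} V j`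
  have hle : (⨆ (j : ι) (_ : j ≠ i), A ⊓ ⨅ k : Fin 2, (V j).comap ((LinearMap.proj k).comp ℓ)) ≤
      (⨆ (j : ι) (_ : j ≠ i), V j).comap ((LinearMap.proj k).comp ℓ) :=
    iSup₂_le fun j hj => (inf_le_right.trans (iInf_le _ k)).trans
      (Submodule.comap_mono (le_iSup₂ (f := fun (j : ι) (_ : j ≠ i) => V j) j hj))
  have h2 : ℓ f k ∈ ⨆ (j : ι) (_ : j ≠ i), V j := by
    have := hle hfrest
    simpa only [Submodule.mem_comap, LinearMap.coe_comp, Function.comp_apply, LinearMap.proj_apply] using this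
  exact Submodule.disjoint_def.mp (iSupIndep_def.mp hV i) _ h1 h2

/-- **Injectivity of a realisation makes its parts faithful**: under the same injectivity, a member of a part with all coordinate
images zero is zero (bookkeeping form used by the folds). [cite: BorelJacquet1979, §4.6] -/
theorem eq_zero_of_mem_part {ι : Type*} (V : ι → Submodule R Y) (A : Submodule R X) (ℓ : X →ₗ[R] (Fin 2 → Y))
    (hℓ : ∀ f ∈ A, (∀ k : Fin 2, ℓ f k = 0) → f = 0) {i : ι} {f : X}
    (hf : f ∈ A ⊓ ⨅ k : Fin 2, (V i).comap ((LinearMap.proj k).comp ℓ)) (h0 : ∀ k : Fin 2, ℓ f k = 0) : f = 0 :=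
  hℓ f (Submodule.mem_inf.mp hf).1 h0

/-- Membership in a part, unfolded: `f ∈ A` and every coordinate image `ℓ f k` lies in `V`. [cite: BorelJacquet1979, §4.6] -/
theorem mem_part_iff (V : Submodule R Y) (A : Submodule R X) (ℓ : X →ₗ[R] (Fin 2 → Y)) (f : X) :
    f ∈ A ⊓ ⨅ k : Fin 2, V.comap ((LinearMap.proj k).comp ℓ) ↔ f ∈ A ∧ ∀ k : Fin 2, ℓ f k ∈ V := by
  simp only [Submodule.mem_inf, Submodule.mem_iInf, Submodule.mem_comap, LinearMap.coe_comp, Function.comp_apply,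
    LinearMap.proj_apply]

/-- **g2 — parts are stable.**  Let `Rg : X →ₗ X` preserve `A`, `Tg : Y →ₗ Y` preserve `V`, and `ℓ` intertwine them on `A`
coordinatewise (`ℓ (Rg f) k = Tg (ℓ f k)` for `f ∈ A`).  Then `Rg` preserves the part `A ⊓ ⨅ k, V.comap (proj k ∘ ℓ)`.  (At the pin:
`Rg = rightRep F V g`, `Tg = R(1, g)` on `L²`, `V = Π.space`, `A = cohForms / holCotForms / conj holCotForms`.) [cite: BorelJacquet1979, §4.6] -/
theorem mem_part_of_mem (V : Submodule R Y) (A : Submodule R X) (ℓ : X →ₗ[R] (Fin 2 → Y)) (Rg : X →ₗ[R] X) (Tg : Y →ₗ[R] Y)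
    (hA : ∀ f ∈ A, Rg f ∈ A) (hℓ : ∀ f ∈ A, ∀ k : Fin 2, ℓ (Rg f) k = Tg (ℓ f k)) (hV : ∀ v ∈ V, Tg v ∈ V) {f : X}
    (hf : f ∈ A ⊓ ⨅ k : Fin 2, V.comap ((LinearMap.proj k).comp ℓ)) :
    Rg f ∈ A ⊓ ⨅ k : Fin 2, V.comap ((LinearMap.proj k).comp ℓ) := by
  rw [mem_part_iff] at hf ⊢
  exact ⟨hA f hf.1, fun k => (hℓ f hf.1 k).symm ▸ hV _ (hf.2 k)⟩

end Parts

end Summit.HodgeConjecture.HodgeConjecture.Cruxes.H413.SpectrumJunction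

end
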